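/-
Copyright (c) 2026 the pub-hodgecm-mathlib formalisation cell (harness21).  Prover seat hodgecm-mathlib-LH4-p06 (g7), req620 Track A «(D-RAM) FOUR-FRAME» squad, helper lane
on h413 = stmt-HodgeConjecture-24833 (count-neutral).  RamM-lane organ (R3) «THE OC-WELD ON TYPE RamM» (dealer LH4-plan (g13) WORD #108 (1); LH4-p07 (g9)
SCOPE-RamM-lane v1 row (R3)): the RamM twin of ★ p860034 `F0P3cDyRamLevelOrderCountsRamKWeldCut`.  2026-09-04.
-/
import Summits.HodgeConjecture.HodgeConjecture.Theorems.F0P3cDyRamToricCensusSumRamMWeldCutV2   -- ★ p860773 (LH4-p08 (g9)): (R2 v2) `toricCensusSum_ramM_weld_cut_v2 ∕ _flip_v2`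
import Summits.HodgeConjecture.HodgeConjecture.Theorems.F0P3cDyRamToricCensusSumRamMCutReindex  -- ★ p860643 (LH4-p07 (g9)): `cutOrderCounts_eq_cutCensusSum_of_cells_ramified`
import Summits.HodgeConjecture.HodgeConjecture.Theorems.F0P3cDyRamToricCensusSumCutReindex      -- ★ p859781 (LH4-p07 (g9)): `sub_eq_sum_ite_sub` (type-free)
import HarnessLib

/-!
# Crux `H413`, line LH4 «(D-RAM) FOUR-FRAME» — RamM lane, organ (R3): «THE LEVEL-PIECE WELD IN ORDER-COUNT CURRENCY, TYPE RamM»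
# `ε·(cutOC_h(μ) − cutOC_{h′}(μ)) = W_RamM(m, jl, C)` — both parity classes, EDITION 2

Cell `hodgecm-mathlib` (D-0151), FLOOR 0, crux item H413 = `stmt-HodgeConjecture-24833`, route of record `HCCMUnconditional`; squad F0∕P3c∕LH4; lane
`--supports stmt-HodgeConjecture-24833 --as helper` (count-neutral; pays NO tier-0 row).  THEOREMS ONLY (no `def`, no instance, no notation, no `sorry`, default heartbeats).
The RamM twin of ★ p860034 (LH4-p07 (g9), RamK): the step «reindex ∘ weld» of the RamM census socket `levelsCensusC` (LH4-p07 (g9); = ★ p860737's `hC` binder) for the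
level pieces, in ORDER-COUNT currency.

THE OBJECT.  Per literal, `cutOC(μ) = Σ_{j ≤ jl} #levelSet(j, 0) + Σ_{b ∈ Icc 1 R} Σ_{j ≤ jl} [j + b ≤ C]·q^b·#levelSetDep(j, b; μ)` over the cells of a multiplier `μ` with
RamM tokens `|μ| = |ϖE|^m`, `|μ − ρμ| = |ϖE^{jl}(α − ρα)|` (`|ϖE| = exp(−2)`; for the level pieces `μ = t⁻¹(λ − u)` at its own tokens — ★ LH4-p08 (g9) (R1)
`…RamMTopCellsScaled`), rows up to the conductor `jl` (`hiff : lam ∈ 𝒪_j ↔ j ≤ jl` for any marker `lam` of that filtration, as in ★ p860643), the diagonal cutoff `C`, and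
cell-depth letters `hRh ∕ hRh′` (`∀ j b, 1 ≤ b → lam ∈ 𝒪_j → levelSetDep(j, b; μ) ≠ ∅ → b ≤ R`).  THIS FILE welds the two literals in that currency:
* **`levelOrderCounts_ramM_weld_cut_v2`** (standard class) = ★ p860773 `toricCensusSum_ramM_weld_cut_v2`'s binders VERBATIM (generic `μ`, per-cell letters (C-1P)(C-1M)
  (C-2GEN)(C-2OFF)(C-2TOPnear)(C-2TOPfarE), `hparW`, `hε`) + `(hΘΘ) (hΘρ) (hμ) (hjl′) (hiff) (hRh) (hRh′)` ⊢ `ε·((cutOC_h : ℕ) − (cutOC_{h′} : ℕ)) =` ★ p860773's value VERBATIM;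
* **`levelOrderCounts_ramM_weld_cut_flip_v2`** (flipped class) — the same over ★ `toricCensusSum_ramM_weld_cut_flip_v2`.
Proof (★ p860034's, token for token): ★ p860643 `cutOrderCounts_eq_cutCensusSum_of_cells_ramified` on both literals, `push_cast`, ★ `sub_eq_sum_ite_sub`, ★ p860773.
HONEST LABEL.  Count-neutral; abstract frame and multiplier, per-cell facts are HYPOTHESES; no CM place, no law asserted; `HC_CM` is proved only modulo the 7 printed
citations (2 remaining named inputs: hLiu418 = `stmt-HodgeConjecture-24832`, h413 = `stmt-HodgeConjecture-24833`) until rung 0 closes.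

## References
* [Kottwitz1986BaseChangeUnits] R. E. Kottwitz, *Base change for unit elements of Hecke algebras*, Compositio Math. 60 (1986): §1 pp. 240–241.
* [Rogawski1990] J. D. Rogawski, *Automorphic Representations of Unitary Groups in Three Variables*, Ann. of Math. Stud. 123 (1990): §4.9 Prop. 4.9.1 (b) p. 55, Lemma 4.9.3 p. 56.
* [Flicker1998UnitaryFL] Y. Z. Flicker, *Elementary proof of the fundamental lemma for a unitary group*, Canad. J. Math. 50 (1998): Prop. 7 p. 84.
* [Jacobowitz1962] R. Jacobowitz, *Hermitian forms over local fields*, Amer. J. Math. 84 (1962): §4.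
-/

set_option autoImplicit false

namespace Summit.HodgeConjecture.HodgeConjecture.Cruxes.H413.F0P3cDyRamLevelOrderCountsRamMWeldCut

open WithZero IsLocalRing Finset
open scoped Valued Classical
open Literature.NumberTheory.Automorphic.UnitaryThreeFourFrame (IsRamifiedQuadraticDatum)
open Summit.HodgeConjecture.HodgeConjecture.Cruxes.H413.F0P3cDyRamToricCensusDefs
open Summit.HodgeConjecture.HodgeConjecture.Cruxes.H413.F0P3cDyRamToricCensusSumCutReindex (sub_eq_sum_ite_sub)
open Summit.HodgeConjecture.HodgeConjecture.Cruxes.H413.F0P3cDyRamToricCensusSumRamMCutReindex (cutOrderCounts_eq_cutCensusSum_of_cells_ramified)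
open Summit.HodgeConjecture.HodgeConjecture.Cruxes.H413.F0P3cDyRamToricCensusSumRamMWeldCutV2 (toricCensusSum_ramM_weld_cut_v2 toricCensusSum_ramM_weld_cut_flip_v2)

variable {K : Type} [Field K] [Valued K ℤᵐ⁰] {ρ Θ : K →+* K} {α ϖE h h' : K} {dρ t : ℕ}

/-! ## §1 Standard parity class -/

/-- **(OC-weldΔ)-RamM, STANDARD CLASS.**  ★ p860773 `toricCensusSum_ramM_weld_cut_v2`'s binders VERBATIM + the reindex letters `(hΘΘ) (hΘρ) (hμ) (hjl′) (hiff)` and the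
cell-depth letters `hRh`, `hRh′`: the two literals' CUT ORDER COUNTS over the cells of `μ` differ, after the sign `ε`, by ★ p860773's value.
[cite: Kottwitz1986BaseChangeUnits, §1 pp. 240–241] [cite: Rogawski1990, §4.9 Prop. 4.9.1 (b) p. 55, Lemma 4.9.3 p. 56] [cite: Flicker1998UnitaryFL, Prop. 7 p. 84] [cite: Jacobowitz1962, §4] -/
theorem levelOrderCounts_ramM_weld_cut_v2 (hD : IsRamifiedQuadraticDatum ρ α dρ t) (hvΘ : ∀ x, Valued.v (Θ x) = Valued.v x)
    (hρϖ : ρ ϖE = ϖE) (hϖE : Valued.v ϖE = exp (-2 : ℤ)) (hh : h ≠ 0) (hh' : h' ≠ 0)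
    (q : ℕ) {g s0 jl m : ℕ} (ε : ℚ) (hq : 2 ≤ q) (hg : 1 ≤ g) (hs0 : 1 ≤ s0) (hjl : jl % 2 = g % 2)
    (hjlS : 3 * g + 2 * s0 ≤ jl + 2 + 2 * ((g + s0) % 2)) (hparW : m % 2 = (g + s0) % 2 ∨ jl + 2 ≤ m + 2 * g + s0)
    (hmS : g + s0 - (g + s0) % 2 ≤ m + 1) (hm : m ≤ jl) (hε : ε = 1 ∨ (ε = -1 ∧ jl + 2 ≤ m + 2 * g + s0)) {μ : K}
    (hC1P : ∀ j a, (levelSet ρ Θ α ϖE h j a).ncard = (if j = 0 then (if a = 0 then 1 else 0) else if j < a then 0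
      else if j - a + 1 = s0 then q ^ j else if j - a + 1 < s0 then (if a = 0 then q ^ j else 0) else if (j - a - s0) % 2 = 1 then 0
      else if a = 0 then (if 2 * g ≤ j - a - s0 then 2 else 1) * q ^ (j - (j - a - s0) / 2)
      else if j - a - s0 + 2 < 2 * g then (q - 1) * q ^ (j - 1 - (j - a - s0) / 2) else if j - a - s0 + 2 = 2 * g then (q - 2) * q ^ (j - 1 - (j - a - s0) / 2)
      else 2 * (q - 1) * q ^ (j - 1 - (j - a - s0) / 2) : ℕ))
    (hC1M : ∀ j a, (levelSet ρ Θ α ϖE h' j a).ncard = (if j = 0 then (if a = 0 then 1 else 0) else if j < a then 0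
      else if j - a + 1 = s0 then q ^ j else if j - a + 1 < s0 then (if a = 0 then q ^ j else 0) else if (j - a - s0) % 2 = 1 then 0
      else if a = 0 then (if j - a - s0 + 2 ≤ 2 * g then q ^ (j - (j - a - s0) / 2) else 0)
      else if j - a - s0 + 2 < 2 * g then (q - 1) * q ^ (j - 1 - (j - a - s0) / 2) else if j - a - s0 + 2 = 2 * g then q ^ (j - (j - a - s0) / 2) else 0 : ℕ))
    (hC2GEN : ∀ j a, j ≤ jl → a ≤ j → (a ≤ m ∧ (j + a ≤ m ∨ (2 * a ≤ m ∧ j + a ≤ jl))) →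
      levelSetDep ρ Θ α ϖE h j a μ = levelSet ρ Θ α ϖE h j a ∧ levelSetDep ρ Θ α ϖE h' j a μ = levelSet ρ Θ α ϖE h' j a)
    (hC2OFF : ∀ j a, j ≤ jl → a ≤ j → ¬ (a ≤ m ∧ (j + a ≤ m ∨ (2 * a ≤ m ∧ j + a ≤ jl))) → j + m ≠ jl + a →
      levelSetDep ρ Θ α ϖE h j a μ = ∅ ∧ levelSetDep ρ Θ α ϖE h' j a μ = ∅)
    (hC2TOPnear : ∀ j a, j ≤ jl → a ≤ j → ¬ (a ≤ m ∧ (j + a ≤ m ∨ (2 * a ≤ m ∧ j + a ≤ jl))) → j + m = jl + a → j + a + 2 ≤ m + s0 + 2 * g →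
      (levelSetDep ρ Θ α ϖE h j a μ).ncard = (levelSetDep ρ Θ α ϖE h' j a μ).ncard)
    (e : ℕ) (hed : e ≤ g + s0)
    (hC2TOPfarE : ∀ j a, j ≤ jl → a ≤ j → ¬ (a ≤ m ∧ (j + a ≤ m ∨ (2 * a ≤ m ∧ j + a ≤ jl))) → j + m = jl + a → ¬ (j + a + 2 ≤ m + s0 + 2 * g) →
      (((levelSetDep ρ Θ α ϖE h j a μ).ncard : ℚ) = if 2 * j + (g + s0) ≤ 2 * jl + 1 + e ∧ ε = 1 then 2 * (q : ℚ) ^ (j - (j + a - m - s0 + 1) / 2) else 0) ∧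
      (((levelSetDep ρ Θ α ϖE h' j a μ).ncard : ℚ) = if 2 * j + (g + s0) ≤ 2 * jl + 1 + e ∧ ε = -1 then 2 * (q : ℚ) ^ (j - (j + a - m - s0 + 1) / 2) else 0))
    (hΘΘ : ∀ x, Θ (Θ x) = x) (hΘρ : ∀ x, Θ (ρ x) = ρ (Θ x))
    (hμ : Valued.v μ = Valued.v ϖE ^ m) (hjl' : Valued.v (μ - ρ μ) = Valued.v (ϖE ^ jl * (α - ρ α)))
    {lam : K} (hiff : ∀ j, IsOrd ρ α (ϖE ^ j) lam ↔ j ≤ jl)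
        (C : ℕ) (hC : jl ≤ C) (hCe : C + (g + s0) ≤ m + jl + 1) {R R' : ℕ}
    (hRh : ∀ j b, 1 ≤ b → IsOrd ρ α (ϖE ^ j) lam → (levelSetDep ρ Θ α ϖE h j b μ).Nonempty → b ≤ R)
    (hRh' : ∀ j b, 1 ≤ b → IsOrd ρ α (ϖE ^ j) lam → (levelSetDep ρ Θ α ϖE h' j b μ).Nonempty → b ≤ R') :
    ε * (((((∑ j ∈ range (jl + 1), (levelSet ρ Θ α ϖE h j 0).ncard) +
            ∑ b ∈ Icc 1 R, ∑ j ∈ range (jl + 1), (if j + b ≤ C then q ^ b * (levelSetDep ρ Θ α ϖE h j b μ).ncard else 0) : ℕ) : ℚ)) -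
          ((((∑ j ∈ range (jl + 1), (levelSet ρ Θ α ϖE h' j 0).ncard) +
            ∑ b ∈ Icc 1 R', ∑ j ∈ range (jl + 1), (if j + b ≤ C then q ^ b * (levelSetDep ρ Θ α ϖE h' j b μ).ncard else 0) : ℕ) : ℚ))) =
      (q : ℚ) ^ m * (2 * ∑ i ∈ range ((jl - g) / 2 + 1), (q : ℚ) ^ i - 2 * ∑ i ∈ range (g + s0 - (g + s0) % 2), (q : ℚ) ^ i) -
        2 * ∑ a ∈ (range (jl + 2)).filter (fun a => a ≤ m ∧ C + m < jl + 2 * a ∧ 2 * m + 2 * g + s0 < jl + 2 * a + 2 ∧ 2 * a + (g + s0) ≤ 2 * m + 1),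
          (q : ℚ) ^ (a + (jl + s0) / 2) := by
  classical
  -- ★ p860643: both literals re-indexed into the cut weld's row∕column shape (rows `range (jl + 1)`, columns `range (jl + 2)`)
  rw [cutOrderCounts_eq_cutCensusSum_of_cells_ramified hD hΘΘ hΘρ hvΘ hρϖ hϖE hh hμ hjl' q hiff hC hRh,
    cutOrderCounts_eq_cutCensusSum_of_cells_ramified hD hΘΘ hΘρ hvΘ hρϖ hϖE hh' hμ hjl' q hiff hC hRh']
  push_cast
  rw [sub_eq_sum_ite_sub]
  exact toricCensusSum_ramM_weld_cut_v2 hD hvΘ hρϖ hϖE hh hh' q ε hq hg hs0 hjl hjlS hparW hmS hm hε hC1P hC1M hC2GEN hC2OFF hC2TOPnear e hed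
    hC2TOPfarE C hC hCe

/-! ## §2 Flipped parity class -/

/-- **(OC-weldΔ)-RamM♭, FLIPPED CLASS.**  The same over ★ p860773 `toricCensusSum_ramM_weld_cut_flip_v2` (its binders VERBATIM + the reindex and cell-depth letters).
[cite: Kottwitz1986BaseChangeUnits, §1 pp. 240–241] [cite: Rogawski1990, §4.9 Prop. 4.9.1 (b) p. 55, Lemma 4.9.3 p. 56] [cite: Flicker1998UnitaryFL, Prop. 7 p. 84] [cite: Jacobowitz1962, §4] -/
theorem levelOrderCounts_ramM_weld_cut_flip_v2 (hD : IsRamifiedQuadraticDatum ρ α dρ t) (hvΘ : ∀ x, Valued.v (Θ x) = Valued.v x)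
    (hρϖ : ρ ϖE = ϖE) (hϖE : Valued.v ϖE = exp (-2 : ℤ)) (hh : h ≠ 0) (hh' : h' ≠ 0)
    (q : ℕ) {g s0 jl m : ℕ} (ε : ℚ) (hq : 2 ≤ q) (hg : 1 ≤ g) (hs0 : 1 ≤ s0) (hjl : jl % 2 = (g + 1) % 2)
    (hjlS : 3 * g + 2 * s0 ≤ jl + 3) (hparW : m % 2 = (g + s0 + 1) % 2 ∨ jl + 2 ≤ m + 2 * g + s0)
    (hmS : g + s0 ≤ m + 1) (hm : m ≤ jl) (hε : ε = 1 ∨ (ε = -1 ∧ jl + 2 ≤ m + 2 * g + s0)) {μ : K}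
    (hC1P : ∀ j a, (levelSet ρ Θ α ϖE h j a).ncard = (if j = 0 then (if a = 0 then 1 else 0) else if j < a then 0
      else if j - a + 1 = s0 then q ^ j else if j - a + 1 < s0 then (if a = 0 then q ^ j else 0) else if (j - a - s0) % 2 = 1 then 0
      else if a = 0 then (if 2 * g ≤ j - a - s0 then 2 else 1) * q ^ (j - (j - a - s0) / 2)
      else if j - a - s0 + 2 < 2 * g then (q - 1) * q ^ (j - 1 - (j - a - s0) / 2) else if j - a - s0 + 2 = 2 * g then (q - 2) * q ^ (j - 1 - (j - a - s0) / 2)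
      else 2 * (q - 1) * q ^ (j - 1 - (j - a - s0) / 2) : ℕ))
    (hC1M : ∀ j a, (levelSet ρ Θ α ϖE h' j a).ncard = (if j = 0 then (if a = 0 then 1 else 0) else if j < a then 0
      else if j - a + 1 = s0 then q ^ j else if j - a + 1 < s0 then (if a = 0 then q ^ j else 0) else if (j - a - s0) % 2 = 1 then 0
      else if a = 0 then (if j - a - s0 + 2 ≤ 2 * g then q ^ (j - (j - a - s0) / 2) else 0)
      else if j - a - s0 + 2 < 2 * g then (q - 1) * q ^ (j - 1 - (j - a - s0) / 2) else if j - a - s0 + 2 = 2 * g then q ^ (j - (j - a - s0) / 2) else 0 : ℕ))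
    (hC2GEN : ∀ j a, j ≤ jl → a ≤ j → (a ≤ m ∧ (j + a ≤ m ∨ (2 * a ≤ m ∧ j + a ≤ jl))) →
      levelSetDep ρ Θ α ϖE h j a μ = levelSet ρ Θ α ϖE h j a ∧ levelSetDep ρ Θ α ϖE h' j a μ = levelSet ρ Θ α ϖE h' j a)
    (hC2OFF : ∀ j a, j ≤ jl → a ≤ j → ¬ (a ≤ m ∧ (j + a ≤ m ∨ (2 * a ≤ m ∧ j + a ≤ jl))) → j + m ≠ jl + a →
      levelSetDep ρ Θ α ϖE h j a μ = ∅ ∧ levelSetDep ρ Θ α ϖE h' j a μ = ∅)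
    (hC2TOPnear : ∀ j a, j ≤ jl → a ≤ j → ¬ (a ≤ m ∧ (j + a ≤ m ∨ (2 * a ≤ m ∧ j + a ≤ jl))) → j + m = jl + a → j + a + 2 ≤ m + s0 + 2 * g →
      (levelSetDep ρ Θ α ϖE h j a μ).ncard = (levelSetDep ρ Θ α ϖE h' j a μ).ncard)
    (e : ℕ) (hed : e ≤ g + s0)
    (hC2TOPfarE : ∀ j a, j ≤ jl → a ≤ j → ¬ (a ≤ m ∧ (j + a ≤ m ∨ (2 * a ≤ m ∧ j + a ≤ jl))) → j + m = jl + a → ¬ (j + a + 2 ≤ m + s0 + 2 * g) →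
      (((levelSetDep ρ Θ α ϖE h j a μ).ncard : ℚ) = if 2 * j + (g + s0) ≤ 2 * jl + 1 + e ∧ ε = 1 then 2 * (q : ℚ) ^ (j - (j + a - m - s0 + 1) / 2) else 0) ∧
      (((levelSetDep ρ Θ α ϖE h' j a μ).ncard : ℚ) = if 2 * j + (g + s0) ≤ 2 * jl + 1 + e ∧ ε = -1 then 2 * (q : ℚ) ^ (j - (j + a - m - s0 + 1) / 2) else 0))
    (hΘΘ : ∀ x, Θ (Θ x) = x) (hΘρ : ∀ x, Θ (ρ x) = ρ (Θ x))
    (hμ : Valued.v μ = Valued.v ϖE ^ m) (hjl' : Valued.v (μ - ρ μ) = Valued.v (ϖE ^ jl * (α - ρ α)))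
    {lam : K} (hiff : ∀ j, IsOrd ρ α (ϖE ^ j) lam ↔ j ≤ jl)
        (C : ℕ) (hC : jl ≤ C) (hCe : C + (g + s0) ≤ m + jl + 1) {R R' : ℕ}
    (hRh : ∀ j b, 1 ≤ b → IsOrd ρ α (ϖE ^ j) lam → (levelSetDep ρ Θ α ϖE h j b μ).Nonempty → b ≤ R)
    (hRh' : ∀ j b, 1 ≤ b → IsOrd ρ α (ϖE ^ j) lam → (levelSetDep ρ Θ α ϖE h' j b μ).Nonempty → b ≤ R') :
    ε * (((((∑ j ∈ range (jl + 1), (levelSet ρ Θ α ϖE h j 0).ncard) +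
            ∑ b ∈ Icc 1 R, ∑ j ∈ range (jl + 1), (if j + b ≤ C then q ^ b * (levelSetDep ρ Θ α ϖE h j b μ).ncard else 0) : ℕ) : ℚ)) -
          ((((∑ j ∈ range (jl + 1), (levelSet ρ Θ α ϖE h' j 0).ncard) +
            ∑ b ∈ Icc 1 R', ∑ j ∈ range (jl + 1), (if j + b ≤ C then q ^ b * (levelSetDep ρ Θ α ϖE h' j b μ).ncard else 0) : ℕ) : ℚ))) =
      (q : ℚ) ^ m * (2 * ∑ i ∈ range ((jl + 1 - g) / 2 + (g + s0) % 2), (q : ℚ) ^ i - 2 * ∑ i ∈ range (g + s0 - 1 + (g + s0) % 2), (q : ℚ) ^ i) -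
        2 * ∑ a ∈ (range (jl + 2)).filter (fun a => a ≤ m ∧ C + m < jl + 2 * a ∧ 2 * m + 2 * g + s0 < jl + 2 * a + 2 ∧ 2 * a + (g + s0) ≤ 2 * m + 1),
          (q : ℚ) ^ (a + (jl + s0) / 2) := by
  classical
  -- ★ p860643: both literals re-indexed into the cut weld's row∕column shape (rows `range (jl + 1)`, columns `range (jl + 2)`)
  rw [cutOrderCounts_eq_cutCensusSum_of_cells_ramified hD hΘΘ hΘρ hvΘ hρϖ hϖE hh hμ hjl' q hiff hC hRh,
    cutOrderCounts_eq_cutCensusSum_of_cells_ramified hD hΘΘ hΘρ hvΘ hρϖ hϖE hh' hμ hjl' q hiff hC hRh']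
  push_cast
  rw [sub_eq_sum_ite_sub]
  exact toricCensusSum_ramM_weld_cut_flip_v2 hD hvΘ hρϖ hϖE hh hh' q ε hq hg hs0 hjl hjlS hparW hmS hm hε hC1P hC1M hC2GEN hC2OFF hC2TOPnear e hed
    hC2TOPfarE C hC hCe

end Summit.HodgeConjecture.HodgeConjecture.Cruxes.H413.F0P3cDyRamLevelOrderCountsRamMWeldCut
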